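import Summits.Ventures.CertifiedManyBodySolver.Downfold.UnanimousBranchRoad

/-!
# The unanimous-branch road, PROPOSAL v0.2: the EPH branch speaks through the channel-CEILING annex (reading β)

Venture CertifiedManyBodySolver, cell `pub/hubbard-downfold`, seat hubbard-downfold-score-2 (session g9,
2026-08-27T06:1xZ); namespace `Summit.Ventures.CertifiedManyBodySolver.Downfold.UnanimousBranch` (continues
`UnanimousBranchRoad.lean`, p501779). Companion of PREREG Y72.

WHAT THIS IS NOT: not the scorer of record, not a ruling; a finite PROVED reading of one proposed text — deputy-2
`PROPOSAL-v19f-unanimous-branch.md` v0.2 (sha16 4ec3ffd3ce8d336f, 2026-08-27T05:40Z), written after score-1's finding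
F23 («band under an UND primary»): reading α (EPH votes by a `Tc_band_K`) is WITHDRAWN; under an UND primary
`Tc_band_K` stays null and the EPH branch speaks only through the column's channel-ceiling annex `T⁺` — «not» for
cells with `T > T⁺`, SILENT for `T ≤ T⁺` (item 7; open point (4): «under β the road can only ever produce «not» cells
where EPH ∈ B — cuprate TPs cannot come from (f)+β»).

PROVED: `ephBeta_ne_SC` (β never says SC); `strict_ne_SC_of_eph_beta` (a word listing EPH is never decided «SC» by the
strict road under β, whatever the boxes say), `loose_ne_SC_of_eph_beta_speaking` (nor by the loose road once EPH
speaks); twin U8 (`u8_decided_not`: above the ceiling all three branches say «not» ⇒ decided «not» both readings;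
`u8_below_ceiling_split`: at or below it the readings separate as in U3); `u1_unreachable_under_beta` (Y70's twin U1
«unanimous SC» cannot occur on a cuprate word under β).
-/

namespace Summit.Ventures.CertifiedManyBodySolver.Downfold

namespace UnanimousBranch

/-- Reading β's EPH statement at a cell of temperature `T` on a column whose channel-ceiling annex is `Tplus`: above the
ceiling the EPH branch says «not», at or below it is silent (a ceiling never asserts SC). [folklore] -/
def ephBeta (Tplus T : ℚ) : Stmt := if Tplus < T then .says .not else .silent

/-- β never lets the EPH branch say «SC». [folklore] -/
theorem ephBeta_ne_SC (Tplus T : ℚ) : ephBeta Tplus T ≠ .says .SC := by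
  unfold ephBeta; split_ifs <;> simp

/-- Under β, a word listing `EPH` can never be decided «SC» by the STRICT road, whatever the boxes say (open point
(4): cuprate TPs cannot come from (f)+β). [folklore] -/
theorem strict_ne_SC_of_eph_beta (B : List Branch) (s : Branch → Stmt) (heph : Branch.EPH ∈ B) (Tplus T : ℚ)
    (hs : s .EPH = ephBeta Tplus T) : roadStrict B s ≠ .decided .SC := by
  intro h
  have := ((strict_eq_decided_iff B s .SC).1 h).2 _ heph
  rw [hs] at this
  exact ephBeta_ne_SC Tplus T this

/-- … nor by the LOOSE road (if EPH speaks it says «not»; if it is silent the boxes alone would have to say SC — but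
then EPH ∈ speakers is false and the claim is about words listing EPH that DO reach SC: impossible once EPH speaks;
stated for the speaking case `Tplus < T`). [folklore] -/
theorem loose_ne_SC_of_eph_beta_speaking (B : List Branch) (s : Branch → Stmt) (heph : Branch.EPH ∈ B)
    (Tplus T : ℚ) (hT : Tplus < T) (hs : s .EPH = ephBeta Tplus T) : roadLoose B s ≠ .decided .SC := by
  intro h
  have hspk : Branch.EPH ∈ speakers B s := mem_speakers.2 ⟨heph, by rw [hs]; simp [ephBeta, hT]⟩
  have := ((loose_eq_decided_iff B s .SC).1 h).2.2 _ hspk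
  rw [hs] at this
  exact ephBeta_ne_SC Tplus T this

/-- U8 (new twin for v0.2): cell ABOVE the ceiling (T⁺ = 40 K, T = 77 K), both boxes say «not», EPH says «not» via
β ⇒ decided «not» under both readings (a TN-type cell, screening-grade); the same column AT 20 K (≤ T⁺): EPH silent
⇒ strict undetermined, loose «not». [folklore] -/
def u8 (T : ℚ) : Branch → Stmt
  | .EPH => ephBeta 40 T
  | _ => .says .not

/-- U8 above the ceiling: decided «not» both ways. [folklore] -/
theorem u8_decided_not : roadStrict bCuprate (u8 77) = .decided .not ∧ roadLoose bCuprate (u8 77) = .decided .not := by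
  decide

/-- U8 at or below the ceiling: the readings separate again exactly as U3 (strict undetermined / loose «not»).
[folklore] -/
theorem u8_below_ceiling_split : roadStrict bCuprate (u8 20) = .undetermined ∧
    roadLoose bCuprate (u8 20) = .decided .not := by
  decide

/-- Under β, U1's «unanimous SC» is unreachable on any word listing EPH: with the two boxes saying SC and EPH read by
β, the strict road is never SC (silent below the ceiling, dissent above it). [folklore] -/
theorem u1_unreachable_under_beta (Tplus T : ℚ) :
    roadStrict bCuprate (fun b => if b = .EPH then ephBeta Tplus T else .says .SC) ≠ .decided .SC :=
  strict_ne_SC_of_eph_beta bCuprate _ (by decide) Tplus T (by simp)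

end UnanimousBranch

end Summit.Ventures.CertifiedManyBodySolver.Downfold
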